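import Mathlib
import HarnessLib
import Summits.ValiantsHypothesis.ValiantsHypothesis.Theorems.LacunarySymmetroidMatrixDescartesOsculationLawUniformDictionary

/-!
# ValiantsHypothesis / LacunarySymmetroid — crux `MatrixDescartes` (stmt-ValiantsHypothesis-18050, V1),
# line «osculation-law»: UNIFORM columns, part 10 — the osculation set of a CONGRUENT pencil is that of its
# polynomial model (the `(det Y)⁻²` bridge for node 2 of `stub_recursion`)

For the full-rank splitting `(m, 0)` and an invertible `Y`, the pencil `S₁ l = (Y⁻¹)ᵀ S'_l Y⁻¹` (val-lit-p4 g13's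
`OsculationRecursion.zmult_node_le`, hypothesis `hS₁`) has insertion polynomial
`det(Σ X₀^(d l) S₁ l + X₁·(I_m ⊕ 0)) = C((det Y)⁻²) · det(Σ X₀^(d l) S'_l + X₁·YᵀY)` (`insertionPoly_inv_congr`): on
`Fin m ⊕ Fin 0` the projector is `1 = (Y⁻¹)ᵀ (YᵀY) Y⁻¹`.  With part 8's `osc_set_C_mul` the line's osculation set of `S₁`
EQUALS the set `{t > 0, b > 0, Φ̃ = 0, H(Φ̃) = 0}` of the Y-FREE model `Φ̃ = det(Σ X₀^(d l) S'_l + X₁·YᵀY)`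
(`osc_set_inv_congr`), which is POLYNOMIAL in the letters (val-port-3 g1's remark: with `YᵀY = S_K + c·1` and
`S' = (S_0, …, S_(K−1), −c·1)` it is `det(G(t) + b·S_K + c(b − tᴺ)·1)`), so parts 8–9 (finiteness from the resultant,
line-genericity in a parameter) apply to node 2.  `mvPencil_congr`, `fromBlocks_one_fin_zero`, `mvPencil_projector_congr`.

Honest framing: helper layer (glue for the general-position density discussion of the OPEN stub `stub_recursion` of an
UNREGISTERED-law V1 line); `stub_osculationLaw` (LAW), `MatrixDescartes`, Conjecture B, `VP ≠ VNP` are OPEN / NOT proved.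
No definitions, no named facts; Mathlib + tree files.
-/

-- `Summit.ValiantsHypothesis.ValiantsHypothesis.…` is the tree's mandated single-conjunct layout (Sub = Summit).
set_option linter.dupNamespace false

noncomputable section

namespace Summit.ValiantsHypothesis.ValiantsHypothesis.Theorems.LacunarySymmetroidMatrixDescartes

namespace OsculationUniform

open scoped BigOperators Matrix

/-! ### Congruence at the level of `MvPolynomial (Fin 2) ℝ` -/

/-- Congruence passes through the coefficient embedding: `Σ X₀^d • (Wᵀ S W).map C = (W.map C)ᵀ (Σ X₀^d • S.map C) (W.map C)`.
[folklore] -/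
theorem mvPencil_congr {ι : Type*} [Fintype ι] [DecidableEq ι] {K : ℕ} (W : Matrix ι ι ℝ) (d : Fin K → ℕ)
    (S : Fin K → Matrix ι ι ℝ) :
    (∑ l, (MvPolynomial.X (0 : Fin 2) : MvPolynomial (Fin 2) ℝ) ^ d l •
        (Wᵀ * S l * W).map (MvPolynomial.C : ℝ →+* MvPolynomial (Fin 2) ℝ)) =
      (W.map (MvPolynomial.C : ℝ →+* MvPolynomial (Fin 2) ℝ))ᵀ *
        (∑ l, (MvPolynomial.X (0 : Fin 2) : MvPolynomial (Fin 2) ℝ) ^ d l •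
          (S l).map (MvPolynomial.C : ℝ →+* MvPolynomial (Fin 2) ℝ)) *
        W.map (MvPolynomial.C : ℝ →+* MvPolynomial (Fin 2) ℝ) := by
  rw [Matrix.mul_sum, Matrix.sum_mul]
  refine Finset.sum_congr rfl fun l _ => ?_
  rw [Matrix.mul_smul, Matrix.smul_mul, Matrix.map_mul, Matrix.map_mul, Matrix.transpose_map]

/-- On `Fin m ⊕ Fin 0` the block projector `I_m ⊕ 0` is the identity. [folklore] -/
theorem fromBlocks_one_fin_zero (m : ℕ) {R : Type*} [Zero R] [One R] :
    (Matrix.fromBlocks 1 0 0 0 : Matrix (Fin m ⊕ Fin 0) (Fin m ⊕ Fin 0) R) = 1 := by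
  ext i j
  rcases i with i | i
  · rcases j with j | j
    · simp [Matrix.one_apply]
    · exact j.elim0
  · exact i.elim0

/-- With the projector: `Σ X₀^d • ((Y⁻¹)ᵀ S' Y⁻¹).map C + X₁ • (I_m ⊕ 0) = (Y⁻¹.map C)ᵀ (Σ X₀^d • S'.map C + X₁ • (YᵀY).map C) (Y⁻¹.map C)`.
[folklore] -/
theorem mvPencil_projector_congr (m : ℕ) {K : ℕ} (Y : Matrix (Fin m ⊕ Fin 0) (Fin m ⊕ Fin 0) ℝ) (hY : Y.det ≠ 0)
    (d : Fin K → ℕ) (S' : Fin K → Matrix (Fin m ⊕ Fin 0) (Fin m ⊕ Fin 0) ℝ) :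
    (∑ l, (MvPolynomial.X (0 : Fin 2) : MvPolynomial (Fin 2) ℝ) ^ d l •
              ((Y⁻¹)ᵀ * S' l * Y⁻¹).map (MvPolynomial.C : ℝ →+* MvPolynomial (Fin 2) ℝ)
            + (MvPolynomial.X (1 : Fin 2) : MvPolynomial (Fin 2) ℝ) •
              (Matrix.fromBlocks 1 0 0 0 : Matrix (Fin m ⊕ Fin 0) (Fin m ⊕ Fin 0) ℝ).map
                (MvPolynomial.C : ℝ →+* MvPolynomial (Fin 2) ℝ)) =
      (Y⁻¹.map (MvPolynomial.C : ℝ →+* MvPolynomial (Fin 2) ℝ))ᵀ *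
        (∑ l, (MvPolynomial.X (0 : Fin 2) : MvPolynomial (Fin 2) ℝ) ^ d l •
              (S' l).map (MvPolynomial.C : ℝ →+* MvPolynomial (Fin 2) ℝ)
            + (MvPolynomial.X (1 : Fin 2) : MvPolynomial (Fin 2) ℝ) •
              (Yᵀ * Y).map (MvPolynomial.C : ℝ →+* MvPolynomial (Fin 2) ℝ)) *
        Y⁻¹.map (MvPolynomial.C : ℝ →+* MvPolynomial (Fin 2) ℝ) := by
  have hYinv : Y * Y⁻¹ = 1 := Matrix.mul_nonsing_inv Y (isUnit_iff_ne_zero.2 hY)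
  have hproj : (Matrix.fromBlocks 1 0 0 0 : Matrix (Fin m ⊕ Fin 0) (Fin m ⊕ Fin 0) ℝ) = (Y⁻¹)ᵀ * (Yᵀ * Y) * Y⁻¹ := by
    rw [fromBlocks_one_fin_zero, ← Matrix.mul_assoc, ← Matrix.transpose_mul, hYinv, Matrix.transpose_one, Matrix.one_mul, hYinv]
  rw [hproj, mvPencil_congr, Matrix.mul_add, Matrix.add_mul, Matrix.mul_smul, Matrix.smul_mul, Matrix.map_mul,
    Matrix.map_mul, Matrix.transpose_map]

/-- **The insertion polynomial of a congruent pencil** (full-rank splitting): `= C((det Y)⁻²) · det(Y-free model)`.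
[folklore] -/
theorem insertionPoly_inv_congr (m : ℕ) {K : ℕ} (Y : Matrix (Fin m ⊕ Fin 0) (Fin m ⊕ Fin 0) ℝ) (hY : Y.det ≠ 0)
    (d : Fin K → ℕ) (S' : Fin K → Matrix (Fin m ⊕ Fin 0) (Fin m ⊕ Fin 0) ℝ) :
    (∑ l, (MvPolynomial.X (0 : Fin 2) : MvPolynomial (Fin 2) ℝ) ^ d l •
              ((Y⁻¹)ᵀ * S' l * Y⁻¹).map (MvPolynomial.C : ℝ →+* MvPolynomial (Fin 2) ℝ)
            + (MvPolynomial.X (1 : Fin 2) : MvPolynomial (Fin 2) ℝ) •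
              (Matrix.fromBlocks 1 0 0 0 : Matrix (Fin m ⊕ Fin 0) (Fin m ⊕ Fin 0) ℝ).map
                (MvPolynomial.C : ℝ →+* MvPolynomial (Fin 2) ℝ)).det =
      MvPolynomial.C ((Y.det)⁻¹ ^ 2) * (∑ l, (MvPolynomial.X (0 : Fin 2) : MvPolynomial (Fin 2) ℝ) ^ d l •
              (S' l).map (MvPolynomial.C : ℝ →+* MvPolynomial (Fin 2) ℝ)
            + (MvPolynomial.X (1 : Fin 2) : MvPolynomial (Fin 2) ℝ) •
              (Yᵀ * Y).map (MvPolynomial.C : ℝ →+* MvPolynomial (Fin 2) ℝ)).det := by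
  rw [mvPencil_projector_congr m Y hY d S', Matrix.det_mul, Matrix.det_mul, Matrix.det_transpose, ← RingHom.mapMatrix_apply,
    ← RingHom.map_det, Matrix.det_nonsing_inv, Ring.inverse_eq_inv', map_pow]
  ring

/-- **The osculation set of the congruent pencil is the osculation-type set of its Y-free model.** [folklore] -/
theorem osc_set_inv_congr (m : ℕ) {K : ℕ} (Y : Matrix (Fin m ⊕ Fin 0) (Fin m ⊕ Fin 0) ℝ) (hY : Y.det ≠ 0)
    (d : Fin K → ℕ) (S' : Fin K → Matrix (Fin m ⊕ Fin 0) (Fin m ⊕ Fin 0) ℝ) :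
    {p : Fin 2 → ℝ | 0 < p 0 ∧ 0 < p 1 ∧ MvPolynomial.eval p (∑ l, (MvPolynomial.X (0 : Fin 2) : MvPolynomial (Fin 2) ℝ) ^ d l •
              ((Y⁻¹)ᵀ * S' l * Y⁻¹).map (MvPolynomial.C : ℝ →+* MvPolynomial (Fin 2) ℝ)
            + (MvPolynomial.X (1 : Fin 2) : MvPolynomial (Fin 2) ℝ) •
              (Matrix.fromBlocks 1 0 0 0 : Matrix (Fin m ⊕ Fin 0) (Fin m ⊕ Fin 0) ℝ).map
                (MvPolynomial.C : ℝ →+* MvPolynomial (Fin 2) ℝ)).det = 0 ∧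
      MvPolynomial.eval p
        (MvPolynomial.X 0 * MvPolynomial.pderiv 0 (MvPolynomial.X 0 * MvPolynomial.pderiv 0 (∑ l, (MvPolynomial.X (0 : Fin 2) : MvPolynomial (Fin 2) ℝ) ^ d l •
              ((Y⁻¹)ᵀ * S' l * Y⁻¹).map (MvPolynomial.C : ℝ →+* MvPolynomial (Fin 2) ℝ)
            + (MvPolynomial.X (1 : Fin 2) : MvPolynomial (Fin 2) ℝ) •
              (Matrix.fromBlocks 1 0 0 0 : Matrix (Fin m ⊕ Fin 0) (Fin m ⊕ Fin 0) ℝ).map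
                (MvPolynomial.C : ℝ →+* MvPolynomial (Fin 2) ℝ)).det)
            * (MvPolynomial.X 1 * MvPolynomial.pderiv 1 (∑ l, (MvPolynomial.X (0 : Fin 2) : MvPolynomial (Fin 2) ℝ) ^ d l •
              ((Y⁻¹)ᵀ * S' l * Y⁻¹).map (MvPolynomial.C : ℝ →+* MvPolynomial (Fin 2) ℝ)
            + (MvPolynomial.X (1 : Fin 2) : MvPolynomial (Fin 2) ℝ) •
              (Matrix.fromBlocks 1 0 0 0 : Matrix (Fin m ⊕ Fin 0) (Fin m ⊕ Fin 0) ℝ).map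
                (MvPolynomial.C : ℝ →+* MvPolynomial (Fin 2) ℝ)).det) ^ 2
          - 2 * (MvPolynomial.X 0 * MvPolynomial.pderiv 0 (MvPolynomial.X 1 * MvPolynomial.pderiv 1 (∑ l, (MvPolynomial.X (0 : Fin 2) : MvPolynomial (Fin 2) ℝ) ^ d l •
              ((Y⁻¹)ᵀ * S' l * Y⁻¹).map (MvPolynomial.C : ℝ →+* MvPolynomial (Fin 2) ℝ)
            + (MvPolynomial.X (1 : Fin 2) : MvPolynomial (Fin 2) ℝ) •
              (Matrix.fromBlocks 1 0 0 0 : Matrix (Fin m ⊕ Fin 0) (Fin m ⊕ Fin 0) ℝ).map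
                (MvPolynomial.C : ℝ →+* MvPolynomial (Fin 2) ℝ)).det))
            * (MvPolynomial.X 0 * MvPolynomial.pderiv 0 (∑ l, (MvPolynomial.X (0 : Fin 2) : MvPolynomial (Fin 2) ℝ) ^ d l •
              ((Y⁻¹)ᵀ * S' l * Y⁻¹).map (MvPolynomial.C : ℝ →+* MvPolynomial (Fin 2) ℝ)
            + (MvPolynomial.X (1 : Fin 2) : MvPolynomial (Fin 2) ℝ) •
              (Matrix.fromBlocks 1 0 0 0 : Matrix (Fin m ⊕ Fin 0) (Fin m ⊕ Fin 0) ℝ).map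
                (MvPolynomial.C : ℝ →+* MvPolynomial (Fin 2) ℝ)).det) * (MvPolynomial.X 1 * MvPolynomial.pderiv 1 (∑ l, (MvPolynomial.X (0 : Fin 2) : MvPolynomial (Fin 2) ℝ) ^ d l •
              ((Y⁻¹)ᵀ * S' l * Y⁻¹).map (MvPolynomial.C : ℝ →+* MvPolynomial (Fin 2) ℝ)
            + (MvPolynomial.X (1 : Fin 2) : MvPolynomial (Fin 2) ℝ) •
              (Matrix.fromBlocks 1 0 0 0 : Matrix (Fin m ⊕ Fin 0) (Fin m ⊕ Fin 0) ℝ).map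
                (MvPolynomial.C : ℝ →+* MvPolynomial (Fin 2) ℝ)).det)
          + MvPolynomial.X 1 * MvPolynomial.pderiv 1 (MvPolynomial.X 1 * MvPolynomial.pderiv 1 (∑ l, (MvPolynomial.X (0 : Fin 2) : MvPolynomial (Fin 2) ℝ) ^ d l •
              ((Y⁻¹)ᵀ * S' l * Y⁻¹).map (MvPolynomial.C : ℝ →+* MvPolynomial (Fin 2) ℝ)
            + (MvPolynomial.X (1 : Fin 2) : MvPolynomial (Fin 2) ℝ) •
              (Matrix.fromBlocks 1 0 0 0 : Matrix (Fin m ⊕ Fin 0) (Fin m ⊕ Fin 0) ℝ).map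
                (MvPolynomial.C : ℝ →+* MvPolynomial (Fin 2) ℝ)).det)
            * (MvPolynomial.X 0 * MvPolynomial.pderiv 0 (∑ l, (MvPolynomial.X (0 : Fin 2) : MvPolynomial (Fin 2) ℝ) ^ d l •
              ((Y⁻¹)ᵀ * S' l * Y⁻¹).map (MvPolynomial.C : ℝ →+* MvPolynomial (Fin 2) ℝ)
            + (MvPolynomial.X (1 : Fin 2) : MvPolynomial (Fin 2) ℝ) •
              (Matrix.fromBlocks 1 0 0 0 : Matrix (Fin m ⊕ Fin 0) (Fin m ⊕ Fin 0) ℝ).map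
                (MvPolynomial.C : ℝ →+* MvPolynomial (Fin 2) ℝ)).det) ^ 2) = 0} =
    {p : Fin 2 → ℝ | 0 < p 0 ∧ 0 < p 1 ∧ MvPolynomial.eval p (∑ l, (MvPolynomial.X (0 : Fin 2) : MvPolynomial (Fin 2) ℝ) ^ d l •
              (S' l).map (MvPolynomial.C : ℝ →+* MvPolynomial (Fin 2) ℝ)
            + (MvPolynomial.X (1 : Fin 2) : MvPolynomial (Fin 2) ℝ) •
              (Yᵀ * Y).map (MvPolynomial.C : ℝ →+* MvPolynomial (Fin 2) ℝ)).det = 0 ∧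
      MvPolynomial.eval p
        (MvPolynomial.X 0 * MvPolynomial.pderiv 0 (MvPolynomial.X 0 * MvPolynomial.pderiv 0 (∑ l, (MvPolynomial.X (0 : Fin 2) : MvPolynomial (Fin 2) ℝ) ^ d l •
              (S' l).map (MvPolynomial.C : ℝ →+* MvPolynomial (Fin 2) ℝ)
            + (MvPolynomial.X (1 : Fin 2) : MvPolynomial (Fin 2) ℝ) •
              (Yᵀ * Y).map (MvPolynomial.C : ℝ →+* MvPolynomial (Fin 2) ℝ)).det)
            * (MvPolynomial.X 1 * MvPolynomial.pderiv 1 (∑ l, (MvPolynomial.X (0 : Fin 2) : MvPolynomial (Fin 2) ℝ) ^ d l •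
              (S' l).map (MvPolynomial.C : ℝ →+* MvPolynomial (Fin 2) ℝ)
            + (MvPolynomial.X (1 : Fin 2) : MvPolynomial (Fin 2) ℝ) •
              (Yᵀ * Y).map (MvPolynomial.C : ℝ →+* MvPolynomial (Fin 2) ℝ)).det) ^ 2
          - 2 * (MvPolynomial.X 0 * MvPolynomial.pderiv 0 (MvPolynomial.X 1 * MvPolynomial.pderiv 1 (∑ l, (MvPolynomial.X (0 : Fin 2) : MvPolynomial (Fin 2) ℝ) ^ d l •
              (S' l).map (MvPolynomial.C : ℝ →+* MvPolynomial (Fin 2) ℝ)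
            + (MvPolynomial.X (1 : Fin 2) : MvPolynomial (Fin 2) ℝ) •
              (Yᵀ * Y).map (MvPolynomial.C : ℝ →+* MvPolynomial (Fin 2) ℝ)).det))
            * (MvPolynomial.X 0 * MvPolynomial.pderiv 0 (∑ l, (MvPolynomial.X (0 : Fin 2) : MvPolynomial (Fin 2) ℝ) ^ d l •
              (S' l).map (MvPolynomial.C : ℝ →+* MvPolynomial (Fin 2) ℝ)
            + (MvPolynomial.X (1 : Fin 2) : MvPolynomial (Fin 2) ℝ) •
              (Yᵀ * Y).map (MvPolynomial.C : ℝ →+* MvPolynomial (Fin 2) ℝ)).det) * (MvPolynomial.X 1 * MvPolynomial.pderiv 1 (∑ l, (MvPolynomial.X (0 : Fin 2) : MvPolynomial (Fin 2) ℝ) ^ d l •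
              (S' l).map (MvPolynomial.C : ℝ →+* MvPolynomial (Fin 2) ℝ)
            + (MvPolynomial.X (1 : Fin 2) : MvPolynomial (Fin 2) ℝ) •
              (Yᵀ * Y).map (MvPolynomial.C : ℝ →+* MvPolynomial (Fin 2) ℝ)).det)
          + MvPolynomial.X 1 * MvPolynomial.pderiv 1 (MvPolynomial.X 1 * MvPolynomial.pderiv 1 (∑ l, (MvPolynomial.X (0 : Fin 2) : MvPolynomial (Fin 2) ℝ) ^ d l •
              (S' l).map (MvPolynomial.C : ℝ →+* MvPolynomial (Fin 2) ℝ)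
            + (MvPolynomial.X (1 : Fin 2) : MvPolynomial (Fin 2) ℝ) •
              (Yᵀ * Y).map (MvPolynomial.C : ℝ →+* MvPolynomial (Fin 2) ℝ)).det)
            * (MvPolynomial.X 0 * MvPolynomial.pderiv 0 (∑ l, (MvPolynomial.X (0 : Fin 2) : MvPolynomial (Fin 2) ℝ) ^ d l •
              (S' l).map (MvPolynomial.C : ℝ →+* MvPolynomial (Fin 2) ℝ)
            + (MvPolynomial.X (1 : Fin 2) : MvPolynomial (Fin 2) ℝ) •
              (Yᵀ * Y).map (MvPolynomial.C : ℝ →+* MvPolynomial (Fin 2) ℝ)).det) ^ 2) = 0} := by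
  rw [insertionPoly_inv_congr m Y hY d S']
  exact osc_set_C_mul _ (pow_ne_zero 2 (inv_ne_zero hY)) _

end OsculationUniform

end Summit.ValiantsHypothesis.ValiantsHypothesis.Theorems.LacunarySymmetroidMatrixDescartes
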